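import Mathlib
import Literature.Geometry.DiscreteGeometry.ShellCensusReplaySound
import Summits.AtomisticToContinuum.Crystallization.Theorems.GappedShellCensusFiveFoldRationingRStubFfrC5CertFacetSign
import Summits.AtomisticToContinuum.Crystallization.Theorems.GappedShellCensusFiveFoldRationingRStubFfrC5NoOpenStarEntry

/-!
# Crux `GappedShellCensus.FiveFoldRationingR` (stmt-AtomisticToContinuum-18071), line `Sketch` —
# entry theorem for the certificate-lane stub `stub_ffrC5NoFarFacet` (C2′: no far-far facet)

The registered stub `stub_ffrC5NoFarFacet` says: a gapped twelve-tuple `t : Fin 12 → ℝ³` (norms in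
`[0.98, 1.02]`, pairwise distances `≥ 0.98`, each pair a bond `≤ 1.02` or far `≥ 1.26`) with shell-degrees
in `[4, 5]` has no three distinct labels `p, q, r` with `pq`, `pr` far that carry a supporting functional
`c` of the normalised shell `u k = t k / ‖t k‖` (`⟪c, u p⟫ = ⟪c, u q⟫ = ⟪c, u r⟫ = 1`, `⟪c, u l⟫ ≤ 1` for
all `l`).  Its proof is a box-search certificate replayed by the checker of
`Literature/Geometry/DiscreteGeometry/ShellCensusReplay.lean` (extended by degree escapes and the facet
leaf), whose soundness theorem delivers an INFEASIBILITY statement in the certificate language: for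

  `P45 = { n := 12, rlo := 49/50, rhi := 51/50, dlo := 49/50, dhi := 51/50, gap := 63/50, eta := 1,
           eps := 0, anchors := [] }`

no `P45`-admissible tuple with shell-degrees in `[4, 5]` satisfying, for every label `l`, the facet sign
condition of `stub_ffrC5CertFacetSign` at `(p, q, r) = (0, 1, 2)`,

  `det[t 0, t 1, t 2] · (‖t 0‖ det[t 1, t 2, t l] − ‖t 1‖ det[t 0, t 2, t l] + ‖t 2‖ det[t 0, t 1, t l]
      − ‖t l‖ det[t 0, t 1, t 2]) ≤ 0`,

satisfies the two decided far pairs `01`, `02` (`Spec.Sat`).  This file is the ENTRY THEOREM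
`ffr_noFarFacet_of_infeasible`: that infeasibility statement implies the registered stub verbatim.

## Proof

Relabel.  The three labels form an injective map `Fin 3 → Fin 12`, which extends to a permutation `σ`
of `Fin 12` (`ffrC5E_exists_perm`); the relabelled tuple `t ∘ σ` is admissible (`Admissible.comp_perm`),
has the same shell-degrees (`ffrC5E_degree`), satisfies the facet sign condition for every `l` by
`stub_ffrC5CertFacetSign` (the functional `c` supports the relabelled shell through `0, 1, 2` because
`σ 0 = p, σ 1 = q, σ 2 = r`), and satisfies the two far constraints.  The relabelling tools
(`ffrC5E_exists_perm`, `ffrC5E_admissible`, `ffrC5E_degree`, `ffrC5E_sat_far`, `ffrC5E_sat_nil`) are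
those of the twin entry file `…StubFfrC5NoOpenStarEntry.lean` (stub `stub_ffrC5NoOpenStar`).
-/

noncomputable section

namespace Summit.AtomisticToContinuum.Crystallization.Theorems

open Literature.Geometry.DiscreteGeometry Literature.Geometry.DiscreteGeometry.ShellCensus

/-! ## The entry theorem -/

/-- **Entry theorem for `stub_ffrC5NoFarFacet` (certificate lane).**  If no `P45`-admissible
twelve-tuple with shell-degrees in `[4, 5]` satisfies, for every label `l`, the facet sign condition
`det[t 0,t 1,t 2] · (‖t 0‖ det[t 1,t 2,t l] − ‖t 1‖ det[t 0,t 2,t l] + ‖t 2‖ det[t 0,t 1,t l] − ‖t l‖ det[t 0,t 1,t 2]) ≤ 0`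
(the determinant form, `stub_ffrC5CertFacetSign`, of "a supporting functional of the normalised shell
passes through `0, 1, 2`") together with the two decided far pairs `01`, `02` — the statement a replayed
box-search certificate with facet leaf proves — then the registered stub holds: no three distinct labels
`p, q, r` of a gapped twelve-tuple with shell-degrees in `[4, 5]`, with `pq` and `pr` far, carry a
supporting functional of the normalised shell. [folklore] -/
theorem ffr_noFarFacet_of_infeasible
    (H : ∀ t : Fin 12 → EuclideanSpace ℝ (Fin 3),
      ({ n := 12, rlo := 49 / 50, rhi := 51 / 50, dlo := 49 / 50, dhi := 51 / 50, gap := 63 / 50, eta := 1,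
          eps := 0, anchors := [] } : Literature.Geometry.DiscreteGeometry.ShellCensus.Spec).Admissible t →
      (∀ k : Fin 12,
        4 ≤ (Finset.univ.filter fun l => l ≠ k ∧ dist (t k) (t l) ≤ ((51 / 50 : ℚ) : ℝ)).card ∧
        (Finset.univ.filter fun l => l ≠ k ∧ dist (t k) (t l) ≤ ((51 / 50 : ℚ) : ℝ)).card ≤ 5) →
      (∀ l : Fin 12,
        Matrix.det !![t 0 0, t 0 1, t 0 2; t 1 0, t 1 1, t 1 2; t 2 0, t 2 1, t 2 2] *
          (‖t 0‖ * Matrix.det !![t 1 0, t 1 1, t 1 2; t 2 0, t 2 1, t 2 2; t l 0, t l 1, t l 2]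
            - ‖t 1‖ * Matrix.det !![t 0 0, t 0 1, t 0 2; t 2 0, t 2 1, t 2 2; t l 0, t l 1, t l 2]
            + ‖t 2‖ * Matrix.det !![t 0 0, t 0 1, t 0 2; t 1 0, t 1 1, t 1 2; t l 0, t l 1, t l 2]
            - ‖t l‖ * Matrix.det !![t 0 0, t 0 1, t 0 2; t 1 0, t 1 1, t 1 2; t 2 0, t 2 1, t 2 2]) ≤ 0) →
      ({ n := 12, rlo := 49 / 50, rhi := 51 / 50, dlo := 49 / 50, dhi := 51 / 50, gap := 63 / 50, eta := 1,
          eps := 0, anchors := [] } : Literature.Geometry.DiscreteGeometry.ShellCensus.Spec).Sat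
        [(0, 1, false), (0, 2, false)] t →
      False)
    (t : Fin 12 → EuclideanSpace ℝ (Fin 3))
    (hn : ∀ k, 1 - 1 / 50 ≤ ‖t k‖ ∧ ‖t k‖ ≤ 1 + 1 / 50)
    (hd : ∀ k l, k ≠ l → 1 - 1 / 50 ≤ dist (t k) (t l) ∧
      (dist (t k) (t l) ≤ 1 + 1 / 50 ∨ 63 / 50 ≤ dist (t k) (t l)))
    (h4 : ∀ k, 4 ≤ (Finset.univ.filter fun l => l ≠ k ∧ dist (t k) (t l) ≤ 1 + 1 / 50).card)
    (h5 : ∀ k, (Finset.univ.filter fun l => l ≠ k ∧ dist (t k) (t l) ≤ 1 + 1 / 50).card ≤ 5) :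
    ∀ p q r : Fin 12, p ≠ q → p ≠ r → q ≠ r →
      63 / 50 ≤ dist (t p) (t q) → 63 / 50 ≤ dist (t p) (t r) →
      (∃ c : EuclideanSpace ℝ (Fin 3), inner ℝ c (‖t p‖⁻¹ • t p) = 1 ∧ inner ℝ c (‖t q‖⁻¹ • t q) = 1 ∧
        inner ℝ c (‖t r‖⁻¹ • t r) = 1 ∧ ∀ l, inner ℝ c (‖t l‖⁻¹ • t l) ≤ 1) → False := by
  intro p q r hpq hpr hqr hfq hfr ⟨c, hcp, hcq, hcr, hcl⟩
  -- relabel: a permutation `σ` with `σ 0 = p, σ 1 = q, σ 2 = r`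
  have hinj : Function.Injective ![p, q, r] := by
    intro i j hij
    fin_cases i <;> fin_cases j <;> simp at hij ⊢
    · exact hpq hij
    · exact hpr hij
    · exact hpq hij.symm
    · exact hqr hij
    · exact hpr hij.symm
    · exact hqr hij.symm
  obtain ⟨σ, hσ⟩ := ffrC5E_exists_perm (by norm_num) ![p, q, r] hinj
  have e0 : σ 0 = p := hσ 0
  have e1 : σ 1 = q := hσ 1
  have e2 : σ 2 = r := hσ 2
  have e0' : ∀ h, σ ⟨0, h⟩ = p := fun _ => hσ 0
  have e1' : ∀ h, σ ⟨1, h⟩ = q := fun _ => hσ 1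
  have e2' : ∀ h, σ ⟨2, h⟩ = r := fun _ => hσ 2
  have hg : ((63 / 50 : ℚ) : ℝ) = 63 / 50 := by norm_num
  refine H (t ∘ σ) ((ffrC5E_admissible t hn hd).comp_perm σ) (ffrC5E_degree t σ h4 h5) (fun l => ?_) ?_
  · -- the facet sign condition at `(0, 1, 2)` for the relabelled tuple
    refine stub_ffrC5CertFacetSign (t ∘ σ) (fun k => hn (σ k)) 0 1 2 l c ?_ ?_ ?_ (hcl (σ l))
    · show inner ℝ c (‖t (σ 0)‖⁻¹ • t (σ 0)) = 1
      rw [e0]; exact hcp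
    · show inner ℝ c (‖t (σ 1)‖⁻¹ • t (σ 1)) = 1
      rw [e1]; exact hcq
    · show inner ℝ c (‖t (σ 2)‖⁻¹ • t (σ 2)) = 1
      rw [e2]; exact hcr
  · -- the two decided far pairs
    refine ffrC5E_sat_far (fun _ _ => ?_) <| ffrC5E_sat_far (fun _ _ => ?_) <| ffrC5E_sat_nil
    · show ((63 / 50 : ℚ) : ℝ) ≤ dist (t (σ _)) (t (σ _))
      rw [e0', e1', hg]; exact hfq
    · show ((63 / 50 : ℚ) : ℝ) ≤ dist (t (σ _)) (t (σ _))
      rw [e0', e2', hg]; exact hfr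

end Summit.AtomisticToContinuum.Crystallization.Theorems
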